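import Summits.CriticalPhenomena.PercolationContinuityZ3.Theorems.PercNearOneGluingNoHeavyPcintLoopExclusionRungSixDimension
import Summits.CriticalPhenomena.PercolationContinuityZ3.Theorems.PercNearOneGluingNoHeavyPcintLoopExclusionRungTenDimension
import Summits.CriticalPhenomena.PercolationContinuityZ3.Theorems.PercNearOneGluingNoHeavyPcintSubleadingChordLaw
import Summits.CriticalPhenomena.PercolationContinuityZ3.Theorems.PercNearOneGluingNoHeavyPcintChordDiagramCount
import HarnessLib

/-!
# CriticalPhenomena/PercolationContinuityZ3 — Theorems/PercNearOneGluingNoHeavyPcintMeanFieldChordLaw.lean: the MEAN-FIELD CONSTANT LAW `c_m = 2·(a(m+1)/(m·a(m)) − 1)` (STRUCTURE P23) — typed, with the four proved rungs `m = 2, 3, 4, 5` as instances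

Lane prim-pcint, STRUCTURE rule «numerics ⇒ structure ⇒ conjecture» (prim-pcint-2 GEN 21; pre-registered as P23, 2026-08-27, sha256 474f5ba0…,
prediction file run/shared/lean/prim/pcint/predictions/P23-mean-field-constant-law-second-memory-deviation-2026-08-27.md).  Sequel of
…PcintLoopExclusionMeanField (`loopCompatMeanField`: `2d·(1 − R_{2m}(d)) → c_m ∈ (0, ∞)` for every rung) and …PcintSubleadingChordLaw (law C5-L4).

THE LAW (C5-L5).  With `a(n)` the connected-chord-diagram numbers (`connChord`), the mean-field constant of the loop-exclusion compatibility defect at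
rung `2m` is
  **`c_m = 2·(a(m+1)/(m·a(m)) − 1) = 2 + 2·Σ_{k=2}^{m−1} a(k)a(m+1−k)/(m·a(m))`**
(equivalently `c_m·a(m) = 2A₂(m+1) − 2a(m)` with `A₂(n) = Σ_{k=1}^{n−1} a(k)a(n−k) = a(n)/(n−1)`): `2, 5/2, 70/27, 159/62, 3542/1415, 46605/19116, 1412710/593859,
6054805/2600428, …` — decreasing from `m = 4` on, with limit `2 = c_2`.  EVIDENCE: found by exact fitting of `c_m·a(m)`, `m = 2..8` (two-term formula, five
redundant exact checks; the values `m ≤ 5` are THEOREMS of the tree, `m = 6, 7` come from the lane's τ = 12, 14 symbolic class automata, `m = 8` from law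
C5-L4); it closes the C5-L3 recipe: the second memory deviation is then `δ_m = [σ^{−(m+1)}](μ_2m − μ) = b(m+1) + a(m+2) − 2A₂(m+2) − (m² − m − 3)a(m+1)`
(`b` = one-defect numbers, `oneDefect`; C5-L6), reproducing `16, 105, 671, 1483, −100187, −3990005`.  PREDICTED (P23, zero tolerance, standing):
`[σ^{−9}] μ_16 = −123 505 485`, `c_9 = 6054805/2600428`, `[σ^{−10}] μ_18 = −3 584 879 275`.

PROVED HERE: the closed form's values `c_2..c_5 = 2, 5/2, 70/27, 159/62` (`meanFieldConst_values`); **the law at `m = 2, 3, 4, 5`** from the tree's rung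
theorems `tendsto_sigma_mul_one_sub_loopCompat_four/six/eight/ten` (…LoopExclusionMeanField, …RungSix/Eight/TenDimension); `c_m ≥ 2` for every `m ≥ 2`
(`two_le_meanFieldConst`, from the Touchard–Riordan recurrence `connChord_succ`), hence the law implies `loopCompatMeanField` (`loopCompatMeanField_of_law`).
NOT proved: the law for `m ≥ 6` (no `1/d` expansion of `μ_{2m}` beyond `τ = 10` in the tree).

HONEST FRAMING: a typed structure law with its first instances; nothing here is used by a certified `p_c` cell.  No `sorry`; standard axioms.
Written by prim-pcint-2 gen 21 (prover-prim-pcint-2-g21-0), 2026-08-27.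
-/

noncomputable section

open Filter Topology
open Literature.Probability.LatticeModels Literature.Probability.Percolation
open Summit.CriticalPhenomena.PercolationContinuityZ3.Theorems.Pcint

namespace Summit.CriticalPhenomena.PercolationContinuityZ3.Theorems.Pcint.MemoryTail

/-- **`c_m = 2·(a(m+1)/(m·a(m)) − 1)`**, the predicted mean-field constant of the rung-`2m` compatibility defect.
STRUCTURE CONJ C5-L5 (prim-pcint-2 gen 21). -/
def meanFieldConst (m : ℕ) : ℝ := 2 * ((connChord (m + 1) : ℝ) / ((m : ℝ) * (connChord m : ℝ)) - 1)

/-- The first values: `c_2, c_3, c_4, c_5 = 2, 5/2, 70/27, 159/62` (the tree's four proved mean-field constants). [folklore] -/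
theorem meanFieldConst_values :
    meanFieldConst 2 = 2 ∧ meanFieldConst 3 = 5 / 2 ∧ meanFieldConst 4 = 70 / 27 ∧ meanFieldConst 5 = 159 / 62 := by
  obtain ⟨-, h2, h3, h4, h5, h6, -⟩ := connChord_values
  unfold meanFieldConst
  rw [h2, h3, h4, h5, h6]
  norm_num

/-- **L5 (STRUCTURE P23): the MEAN-FIELD CONSTANT LAW** — `2d·(1 − R_{2m}(d)) → 2·(a(m+1)/(m·a(m)) − 1)` as `d → ∞`, for every `m ≥ 2`.
Proved below for `m ≤ 5`; `m = 6, 7, 8` agree with the lane's exact constants `3542/1415, 46605/19116, 1412710/593859`.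
STRUCTURE CONJ C5-L5 (prim-pcint-2 gen 21, 2026-08-27; not kernel-checked beyond `m = 5`). -/
@[conjecture] def loopCompatMeanFieldLaw : Prop :=
  ∀ m : ℕ, 2 ≤ m → Tendsto (fun d : ℕ => (2 * (d : ℝ)) * (1 - loopCompat d (2 * m))) atTop (𝓝 (meanFieldConst m))

/-- **L5 at `m = 2`** (`c_2 = 2`). [folklore] -/
theorem loopCompatMeanFieldLaw_two :
    Tendsto (fun d : ℕ => (2 * (d : ℝ)) * (1 - loopCompat d (2 * 2))) atTop (𝓝 (meanFieldConst 2)) := by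
  rw [meanFieldConst_values.1]; exact tendsto_sigma_mul_one_sub_loopCompat_four

/-- **L5 at `m = 3`** (`c_3 = 5/2`). [folklore] -/
theorem loopCompatMeanFieldLaw_three :
    Tendsto (fun d : ℕ => (2 * (d : ℝ)) * (1 - loopCompat d (2 * 3))) atTop (𝓝 (meanFieldConst 3)) := by
  rw [meanFieldConst_values.2.1]; exact tendsto_sigma_mul_one_sub_loopCompat_six

/-- **L5 at `m = 4`** (`c_4 = 70/27`). [folklore] -/
theorem loopCompatMeanFieldLaw_four :
    Tendsto (fun d : ℕ => (2 * (d : ℝ)) * (1 - loopCompat d (2 * 4))) atTop (𝓝 (meanFieldConst 4)) := by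
  rw [meanFieldConst_values.2.2.1]; exact tendsto_sigma_mul_one_sub_loopCompat_eight

/-- **L5 at `m = 5`** (`c_5 = 159/62`). [folklore] -/
theorem loopCompatMeanFieldLaw_five :
    Tendsto (fun d : ℕ => (2 * (d : ℝ)) * (1 - loopCompat d (2 * 5))) atTop (𝓝 (meanFieldConst 5)) := by
  rw [meanFieldConst_values.2.2.2]; exact tendsto_sigma_mul_one_sub_loopCompat_ten

/-- **L5 holds at every rung `2 ≤ m ≤ 5`.** [folklore] -/
theorem loopCompatMeanFieldLaw_of_le_five (m : ℕ) (hm : 2 ≤ m) (hm5 : m ≤ 5) :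
    Tendsto (fun d : ℕ => (2 * (d : ℝ)) * (1 - loopCompat d (2 * m))) atTop (𝓝 (meanFieldConst m)) := by
  interval_cases m
  · exact loopCompatMeanFieldLaw_two
  · exact loopCompatMeanFieldLaw_three
  · exact loopCompatMeanFieldLaw_four
  · exact loopCompatMeanFieldLaw_five

/-- `a(m) ≥ 1` for `m ≥ 1` (irreducible diagrams exist on every even number of points). [folklore] -/
theorem one_le_connChord : ∀ m : ℕ, 1 ≤ m → 1 ≤ connChord m := by
  intro m hm
  induction m with
  | zero => omega
  | succ n ih =>
    rcases Nat.eq_zero_or_pos n with rfl | hn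
    · simp [connChord_values.1]
    · rw [ChordDiag.connChord_succ (by omega)]
      have h1 := ih (by omega)
      have hterm : 1 ≤ connChord (0 + 1) * connChord (n - 0) := by
        rw [Nat.sub_zero, zero_add, connChord_values.1, one_mul]; exact h1
      have hsum : connChord (0 + 1) * connChord (n - 0) ≤ ∑ k ∈ Finset.range n, connChord (k + 1) * connChord (n - k) :=
        Finset.single_le_sum (f := fun k => connChord (k + 1) * connChord (n - k)) (fun _ _ => Nat.zero_le _) (Finset.mem_range.2 hn)
      calc 1 ≤ n * 1 := by omega
        _ ≤ n * ∑ k ∈ Finset.range n, connChord (k + 1) * connChord (n - k) := Nat.mul_le_mul_left _ (le_trans hterm hsum)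

/-- **`a(m+1) ≥ 2m·a(m)`** for `m ≥ 2`: the two extreme terms of the Touchard–Riordan recurrence. [folklore] -/
theorem two_mul_mul_connChord_le (m : ℕ) (hm : 2 ≤ m) : 2 * m * connChord m ≤ connChord (m + 1) := by
  rw [ChordDiag.connChord_succ (by omega)]
  have h0 : 0 ∈ Finset.range m := Finset.mem_range.2 (by omega)
  have h1 : m - 1 ∈ Finset.range m := Finset.mem_range.2 (by omega)
  have hne : (0 : ℕ) ≠ m - 1 := by omega
  have hsub : ({0, m - 1} : Finset ℕ) ⊆ Finset.range m := by
    intro k hk; rw [Finset.mem_insert, Finset.mem_singleton] at hk; rcases hk with rfl | rfl <;> assumption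
  have hle := Finset.sum_le_sum_of_subset_of_nonneg hsub (f := fun k => connChord (k + 1) * connChord (m - k)) (fun _ _ _ => Nat.zero_le _)
  rw [Finset.sum_pair hne] at hle
  have e1 : connChord (0 + 1) * connChord (m - 0) = connChord m := by rw [zero_add, Nat.sub_zero, connChord_values.1, one_mul]
  have e2 : connChord (m - 1 + 1) * connChord (m - (m - 1)) = connChord m := by
    rw [show m - 1 + 1 = m by omega, show m - (m - 1) = 1 by omega, connChord_values.1, mul_one]
  rw [e1, e2] at hle
  calc 2 * m * connChord m = m * (connChord m + connChord m) := by ring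
    _ ≤ m * ∑ k ∈ Finset.range m, connChord (k + 1) * connChord (m - k) := Nat.mul_le_mul_left _ hle

/-- **`c_m ≥ 2`** for every `m ≥ 2` (with equality only at `m = 2`). [folklore] -/
theorem two_le_meanFieldConst (m : ℕ) (hm : 2 ≤ m) : 2 ≤ meanFieldConst m := by
  unfold meanFieldConst
  have ha : (1 : ℝ) ≤ connChord m := by exact_mod_cast one_le_connChord m (by omega)
  have hm' : (2 : ℝ) ≤ m := by exact_mod_cast hm
  have hpos : (0 : ℝ) < (m : ℝ) * (connChord m : ℝ) := by positivity
  have hle : (2 : ℝ) * m * connChord m ≤ connChord (m + 1) := by exact_mod_cast two_mul_mul_connChord_le m hm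
  have h2 : (2 : ℝ) ≤ (connChord (m + 1) : ℝ) / ((m : ℝ) * (connChord m : ℝ)) := by
    rw [le_div_iff₀ hpos]; linarith
  linarith

/-- **The law implies `loopCompatMeanField`** (the constants are positive). [folklore] -/
theorem loopCompatMeanField_of_law (h : loopCompatMeanFieldLaw) : loopCompatMeanField := by
  intro m hm
  exact ⟨meanFieldConst m, by have := two_le_meanFieldConst m hm; linarith, h m hm⟩

end Summit.CriticalPhenomena.PercolationContinuityZ3.Theorems.Pcint.MemoryTail
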